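import Summits.CriticalPhenomena.CardyFormulaZ2.Theses.CardyWickAnisotropy
import Summits.CriticalPhenomena.CardyFormulaZ2.Theorems.CardyWickAnisotropyVitaliStep
import Summits.CriticalPhenomena.CardyFormulaZ2.Theorems.CardyWickAnisotropyRealAxisDictionary
import HarnessLib

/-!
# Route CardyWickAnisotropy — the assembly (item `stmt-CriticalPhenomena-14614`)

`Assembly : DiscNormality → TaylorIdentification → BoxFamilyToCardy → CardyFormulaZ2`.

The load-bearing cruxes alone imply the conjunct. This is not pure logic: the two provable-now
supports of the route are used as theorems of the tree —

* `vitaliStep_proof : VitaliStep`, i.e.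
  `DiscNormality → TaylorIdentification → RealAxisDictionary → AnisotropicBoxCardy`
  (Taylor expansion on the disc `D = ball (1/2) (1/2)`, Cauchy's inequalities from the uniform
  bound, dominated convergence of the series; `CardyWickAnisotropyVitaliStep.lean`);
* `realAxisDictionary_proof : RealAxisDictionary` (the real diameter of `D` is the critical
  line: `V_n (criticalWeight (α/2))` is the `prodBernoulli (P α)`-probability of
  `lrCrossing (n+1) n`; `CardyWickAnisotropyRealAxisDictionary.lean`).

With these, `DiscNormality` and `TaylorIdentification` give the waypoint `AnisotropicBoxCardy`,
and the crux `BoxFamilyToCardy : AnisotropicBoxCardy → CardyFormulaZ2` finishes: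
`fun hN hT hU ↦ hU (vitaliStep_proof hN hT realAxisDictionary_proof)`.
-/

namespace Summit.CriticalPhenomena.CardyFormulaZ2.Theorems

open Summit.CriticalPhenomena.CardyFormulaZ2.Theses.CardyWickAnisotropy

/-- **Item `stmt-CriticalPhenomena-14614` (assembly of route CardyWickAnisotropy).**
`DiscNormality → TaylorIdentification → BoxFamilyToCardy → CardyFormulaZ2`: the Vitali step
(`vitaliStep_proof`) fed with the real-axis dictionary (`realAxisDictionary_proof`) turns the
two analytic cruxes into `AnisotropicBoxCardy`, and `BoxFamilyToCardy` carries the anisotropic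
box family to Cardy's formula on `ℤ²`. -/
theorem cardyWickAnisotropy_assembly_proof :
    Summit.CriticalPhenomena.CardyFormulaZ2.Theses.CardyWickAnisotropy.Assembly := by
  unfold Summit.CriticalPhenomena.CardyFormulaZ2.Theses.CardyWickAnisotropy.Assembly
  intro hN hT hU
  -- the Vitali step, with the real-axis dictionary discharged, gives the waypoint
  have hV : VitaliStep := vitaliStep_proof
  unfold VitaliStep at hV
  have hA : AnisotropicBoxCardy := hV hN hT realAxisDictionary_proof
  -- the crux `BoxFamilyToCardy` carries the box family to Cardy's formula
  unfold BoxFamilyToCardy at hU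
  exact hU hA

end Summit.CriticalPhenomena.CardyFormulaZ2.Theorems
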